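import Summits.BirchSwinnertonDyer.BirchSwinnertonDyer.Theorems.PrintCf2RubinValueTwoKatoZetaInEllClosure
import Literature.NumberTheory.EllipticCurves.IwasawaAlgebraSemilinearCharIdealProofs
import Literature.NumberTheory.EllipticCurves.IwasawaAlgebraRankOneIdealProofs
import Literature.NumberTheory.EllipticCurves.IwasawaAlgebraStructureProofs
import HarnessLib

/-!
# `(T₁, T₂)`-DIFFERENCES ARE INVISIBLE TO TWO-VARIABLE CHARACTERISTIC IDEALS: if `ℐ·A ⊆ B` for the augmentation ideal
# `ℐ = (T₁, T₂) ⊆ Λ₂ = ℤ_p⟦T₁, T₂⟧`, then `char_{Λ₂}(N ⧸ B) = char_{Λ₂}(N ⧸ (A + B))`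

Cell `bsd-print-cf2`, width seat `bsd-line-cf2c-w7` g24, route C `PrintCf2RubinValueTwo`; `--supports` crux stmt-BirchSwinnertonDyer-24033
`TwoVariableMainConjAtSplitTwoQuad` (23720 nominal), BRICK §4(c), item D4 (closure comparison of the two elliptic-unit systems inside `U¹_∞(𝔓)`)
of `Cruxes/TwoVariableMainConjAtSplitTwoQuad/BRICK-C-ITEMS-g24.md` §2 (D4b): the LIMIT ALGEBRA that turns the levelwise containment
«`(σ − 1)·Θ(1; 𝔪, 𝔞) ∈ 𝒞_Rubin(K(𝔪))¹²`» (`Literature/…/EllipticUnits/ThetaValueOneRubinUnits`, p812995) — i.e. `ℐ·A ⊆ B` for the closed `Λ₂`-spans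
`A` (the lane's Θ-units) and `B` (Rubin's `𝒞̄`) — into the equality of characteristic ideals `char(U/B) = char(U/(A+B))`.  The same algebra is the
characteristic-ideal form of ROW 2's pointwise `hCZ` (`KatoZetaEllClosure.hCZ_of_prints`: «`∀ 𝔭` of height `≤ 1`, `∃ r ∉ 𝔭`, `r·z ∈ C̃`»).
THEOREMS ONLY (no `def`, no named fact, no `sorry`); UNCONDITIONAL; Theses-free; nothing here closes the crux; BSD is not proved by any of this.

* ★ `isPseudoNull_of_X_smul_eq_zero_of_C_X_smul_eq_zero` — **a `Λ₂`-module killed by `T₁ = X` and `T₂ = C X` is PSEUDO-NULL** (pointwise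
  criterion `Module.isPseudoNull_iff` + -w2 g18's `KatoZetaEllClosure.exists_mem_span_X_CX_not_mem`: `ℐ ⊄ 𝔭` for every `𝔭` of height `≤ 1`,
  itself from cf2c-w8's `JLKDescent.forall_exists_smul_eq_zero_of_exists_finset_iwasawaAlgebra₂` — `Λ₂/ℐ ≅ ℤ_p`);
* ★ `isPseudoNull_map_mkQ_sup_of_smul_mem` — for submodules `A, B ≤ N` with `X·A ⊆ B`, `C X·A ⊆ B`, the submodule `(A ⊔ B) ⧸ B` of `N ⧸ B`
  (`(A ⊔ B).map B.mkQ`) is killed by `ℐ`, hence pseudo-null;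
* ★★ **`charIdeal_quotient_eq_of_X_smul_mem_of_C_X_smul_mem`** — with `N ⧸ B` finitely generated torsion:
  **`Module.charIdeal Λ₂ (N ⧸ B) = Module.charIdeal Λ₂ (N ⧸ (A ⊔ B))`** (`char((A⊔B)/B) · char(N/(A⊔B)) = char(N/B)`,
  `charIdeal_quotient_mul_charIdeal_quotient_map`, and `char(pseudo-null) = 1`, `charIdeal_eq_top_of_isPseudoNull`);
* `charIdeal_quotient_eq_of_le_sup` — if for every `a ∈ A` both `X·a ∈ B` and
  `C X·a ∈ B`, and `A' ≤ A ⊔ B`, then `char(N/B) = char(N/(A' ⊔ B))` as well (monotonicity in between: `B ≤ A' ⊔ B ≤ A ⊔ B`).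

## References
* [BourbakiAC5to7] N. Bourbaki, *Algèbre commutative* Ch. VII §4 no. 5 (characteristic ideals are multiplicative; pseudo-null modules are invisible).
* [JohnsonLeungKings2011] J. Johnson-Leung, G. Kings, J. reine angew. Math. 653 (2011), §5.1 (arXiv:0804.2828 p0014 L40–48: `Λ/𝒥_Λ ≅ ℤ_p` is pseudo-null).
* [deShalit1987] E. de Shalit, *Iwasawa theory of elliptic curves with complex multiplication* (1987), III §1.4 (5), Lemma 1.10.
-/

-- the summit namespace `Summit.BirchSwinnertonDyer.BirchSwinnertonDyer` repeats the problem name by design (D-0017)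
set_option linter.dupNamespace false
set_option autoImplicit false

noncomputable section

open scoped Classical
open Literature.NumberTheory.EllipticCurves
open Summit.BirchSwinnertonDyer.BirchSwinnertonDyer.Theorems.PrintCf2

namespace Summit.BirchSwinnertonDyer.BirchSwinnertonDyer.Theorems.PrintCf2.AugmentationInsensitive

variable {p : ℕ} [Fact p.Prime]

/-! ## §1. Killed by `(T₁, T₂)` ⟹ pseudo-null -/

/-- ★ **A `Λ₂`-module killed by `T₁ = X` and `T₂ = C X` is pseudo-null** (it is a module over `Λ₂/ℐ ≅ ℤ_p`, and `ℐ = (X, C X)` lies in no prime of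
height `≤ 1`). [cite: JohnsonLeungKings2011, §5.1 (arXiv p0014:L40–48)] [cite: BourbakiAC5to7, Ch. VII §4 no. 5] -/
theorem isPseudoNull_of_X_smul_eq_zero_of_C_X_smul_eq_zero {M : Type*} [AddCommGroup M] [Module (IwasawaAlgebra₂ p) M]
    (hX : ∀ m : M, (PowerSeries.X : IwasawaAlgebra₂ p) • m = 0)
    (hCX : ∀ m : M, (PowerSeries.C (PowerSeries.X : IwasawaAlgebra p) : IwasawaAlgebra₂ p) • m = 0) :
    Module.IsPseudoNull (IwasawaAlgebra₂ p) M := by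
  rw [Module.isPseudoNull_iff]
  intro 𝔭 h𝔭 m
  obtain ⟨r, hr, hr𝔭⟩ := KatoZetaEllClosure.exists_mem_span_X_CX_not_mem (p := p) 𝔭 h𝔭
  refine ⟨r, hr𝔭, ?_⟩
  obtain ⟨a, b, rfl⟩ := Ideal.mem_span_pair.mp hr
  rw [add_smul, mul_smul, mul_smul, hX, hCX, smul_zero, smul_zero, add_zero]

variable {N : Type*} [AddCommGroup N] [Module (IwasawaAlgebra₂ p) N]

/-- The class in `N ⧸ B` of an element of `A ⊔ B` is the class of an element of `A`. [folklore] -/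
theorem exists_mem_mkQ_eq_of_mem_sup (A B : Submodule (IwasawaAlgebra₂ p) N) {y : N} (hy : y ∈ A ⊔ B) :
    ∃ a ∈ A, B.mkQ a = B.mkQ y := by
  obtain ⟨a, ha, b, hb, rfl⟩ := Submodule.mem_sup.mp hy
  refine ⟨a, ha, ?_⟩
  have hb0 : B.mkQ b = 0 := (Submodule.Quotient.mk_eq_zero B).mpr hb
  rw [map_add, hb0, add_zero]

/-- ★ **`(A ⊔ B) ⧸ B` is pseudo-null when `X·A ⊆ B` and `C X·A ⊆ B`** (it is killed by `ℐ`). [cite: BourbakiAC5to7, Ch. VII §4 no. 5]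
[cite: JohnsonLeungKings2011, §5.1 (arXiv p0014:L40–48)] -/
theorem isPseudoNull_map_mkQ_sup_of_smul_mem (A B : Submodule (IwasawaAlgebra₂ p) N)
    (hX : ∀ a ∈ A, (PowerSeries.X : IwasawaAlgebra₂ p) • a ∈ B)
    (hCX : ∀ a ∈ A, (PowerSeries.C (PowerSeries.X : IwasawaAlgebra p) : IwasawaAlgebra₂ p) • a ∈ B) :
    Module.IsPseudoNull (IwasawaAlgebra₂ p) ↥((A ⊔ B).map B.mkQ) := by
  refine isPseudoNull_of_X_smul_eq_zero_of_C_X_smul_eq_zero (fun x ↦ ?_) (fun x ↦ ?_)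
  all_goals
    obtain ⟨y, hy, hxy⟩ := (Submodule.mem_map.mp x.2)
    obtain ⟨a, ha, hay⟩ := exists_mem_mkQ_eq_of_mem_sup A B hy
    apply Subtype.ext
    rw [Submodule.coe_smul, ← hxy, ← hay, ← map_smul, Submodule.coe_zero, Submodule.mkQ_apply, Submodule.Quotient.mk_eq_zero]
  · exact hX a ha
  · exact hCX a ha

/-! ## §2. The characteristic ideals -/

/-- ★★ **`char(N ⧸ B) = char(N ⧸ (A ⊔ B))` when `ℐ·A ⊆ B`** (`N ⧸ B` finitely generated torsion over `Λ₂`): the quotient `(A ⊔ B)/B` is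
pseudo-null, so `char(N/B) = char((A⊔B)/B)·char(N/(A⊔B)) = char(N/(A⊔B))`.  The limit algebra of D4(a)(b): `(σ−1)`-translates of one
elliptic-unit system lying in the other system do not change two-variable characteristic ideals.
[cite: BourbakiAC5to7, Ch. VII §4 no. 5] [cite: deShalit1987, III §1.4 (5), Lemma 1.10] [cite: JohnsonLeungKings2011, §5.1] -/
theorem charIdeal_quotient_eq_of_X_smul_mem_of_C_X_smul_mem (A B : Submodule (IwasawaAlgebra₂ p) N)
    [Module.Finite (IwasawaAlgebra₂ p) (N ⧸ B)] (hB : Module.IsTorsion (IwasawaAlgebra₂ p) (N ⧸ B))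
    (hX : ∀ a ∈ A, (PowerSeries.X : IwasawaAlgebra₂ p) • a ∈ B)
    (hCX : ∀ a ∈ A, (PowerSeries.C (PowerSeries.X : IwasawaAlgebra p) : IwasawaAlgebra₂ p) • a ∈ B) :
    Module.charIdeal (IwasawaAlgebra₂ p) (N ⧸ B) = Module.charIdeal (IwasawaAlgebra₂ p) (N ⧸ (A ⊔ B)) := by
  rw [← Module.charIdeal_quotient_mul_charIdeal_quotient_map B (A ⊔ B) le_sup_right hB,
    Module.charIdeal_eq_top_of_isPseudoNull (isPseudoNull_map_mkQ_sup_of_smul_mem A B hX hCX), Ideal.top_mul]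

/-- **Intermediate submodules**: under the same hypothesis, `char(N ⧸ B) = char(N ⧸ (A' ⊔ B))` for EVERY `A' ≤ A ⊔ B` (e.g. `A' = 4·A`, the twelfth =
fourth powers of the lane's units inside Rubin's closure): `B ≤ A' ⊔ B ≤ A ⊔ B` and the two ends have the same characteristic ideal.
[cite: BourbakiAC5to7, Ch. VII §4 no. 5] -/
theorem charIdeal_quotient_eq_of_le_sup (A A' B : Submodule (IwasawaAlgebra₂ p) N)
    [Module.Finite (IwasawaAlgebra₂ p) (N ⧸ B)] (hB : Module.IsTorsion (IwasawaAlgebra₂ p) (N ⧸ B))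
    (hX : ∀ a ∈ A, (PowerSeries.X : IwasawaAlgebra₂ p) • a ∈ B)
    (hCX : ∀ a ∈ A, (PowerSeries.C (PowerSeries.X : IwasawaAlgebra p) : IwasawaAlgebra₂ p) • a ∈ B)
    (hA' : A' ≤ A ⊔ B) :
    Module.charIdeal (IwasawaAlgebra₂ p) (N ⧸ B) = Module.charIdeal (IwasawaAlgebra₂ p) (N ⧸ (A' ⊔ B)) := by
  have h₁ : B ≤ A' ⊔ B := le_sup_right
  have h₂ : A' ⊔ B ≤ A ⊔ B := sup_le hA' le_sup_right
  haveI : Module.Finite (IwasawaAlgebra₂ p) (N ⧸ (A' ⊔ B)) :=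
    Module.Finite.of_surjective (Submodule.factor h₁) (Submodule.factor_surjective h₁)
  have hB' : Module.IsTorsion (IwasawaAlgebra₂ p) (N ⧸ (A' ⊔ B)) := fun x ↦ by
    obtain ⟨y, rfl⟩ := Submodule.factor_surjective h₁ x
    obtain ⟨r, hr⟩ := @hB y
    refine ⟨r, ?_⟩
    rw [Submonoid.smul_def, ← map_smul, ← Submonoid.smul_def, hr, map_zero]
  refine le_antisymm (Module.charIdeal_quotient_mono B (A' ⊔ B) h₁ hB) ?_
  rw [charIdeal_quotient_eq_of_X_smul_mem_of_C_X_smul_mem A B hB hX hCX]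
  exact Module.charIdeal_quotient_mono (A' ⊔ B) (A ⊔ B) h₂ hB'

end Summit.BirchSwinnertonDyer.BirchSwinnertonDyer.Theorems.PrintCf2.AugmentationInsensitive
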